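import Mathlib
import HarnessLib
import Summits.Ventures.LatticeQCDFlow.Exactness.JarzynskiEstimatorBias
import Summits.Ventures.LatticeQCDFlow.Exactness.SampleESS
import Summits.Ventures.LatticeQCDFlow.Exactness.RatioEstimator
import Summits.Ventures.LatticeQCDFlow.Exactness.NCMCGeneralSpaceDissipation

/-!
# The engine's estimators on a general state space: variance of the exponential average, strong consistency of `ΔF̂`, of the ESS fraction and of reweighted observables

HONEST FRAMING: exact (Metropolis-corrected) sampling algorithms for lattice gauge theory;
figures of merit are autocorrelation/cost numbers at stated couplings and volumes; no
continuum-physics claim.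

Venture `LatticeQCDFlow` (cell pub-lqcd), topic `Exactness`; FANOUT row 13 (`eng-snf`, GEN-11).
NEW WORK of the cell (elementary probability on product laws: Mathlib's `variance_sum_pi`,
`iIndepFun_infinitePi`, Etemadi's strong law `ProbabilityTheory.strong_law_ae`), not a published
result; nothing is cited as a fact (C. Jarzynski, Phys. Rev. Lett. 78 (1997) 2690; A. Kong,
"A note on importance sampling using standardized weights", U. Chicago Tech. Rep. 348 (1992) — the
`ESS = n/(1 + cv²)` reading — named only).  Continuation of `NCMCGeneralSpaceDissipation.lean`
(population ESS `ESS_F = (E_F e^{−W})² / E_F e^{−2W}`), of row 30's abstract `RatioEstimator.lean`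
(`ratio_estimator_consistent`, sequences on an unspecified space) and of row 19's finite
`SampleESS.lean` (`essHat`); the vocabulary `sampleMean` / `jarzynskiEstimate` of
`JarzynskiEstimatorBias.lean` is reused verbatim.

## Setting and content

`μ` a probability law on records `E` (think `P_F = fwdPathLaw ν₀ κF`), `w : E → ℝ` a weight (think
`e^{−W}`); `N` i.i.d. records carry `Measure.pi (fun _ : Fin N => μ)`, an infinite run carries
`Measure.infinitePi (fun _ : ℕ => μ)` on `ℕ → E`, and the estimate after `n` records of the run `ω`
is `jarzynskiEstimate w (fun i : Fin n => ω i) = −log ((1/n) Σ_{i<n} w(ω i))`.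

* **`variance_sampleMean_pi`** — `Var[(1/N) Σ_i w(y i)] = Var_μ[w] / N` (`w ∈ L²(μ)`, `N ≥ 1`);
  for a Crooks pair **`CrooksPair.variance_exp_neg_work_div_sq`** — THE RELATIVE VARIANCE OF THE
  JARZYNSKI WEIGHT IS `1/ESS_F − 1`: `Var_{P_F}[e^{−W}] / (E_{P_F} e^{−W})² =
  (E_F e^{−2W}) / (E_F e^{−W})² − 1`, hence **`CrooksPair.variance_sampleMean_exp_neg_work`** — the
  `N`-evolution exponential average `(1/N) Σ e^{−W_i}` (whose mean is `e^{−ΔF}`) has relative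
  variance `(1/ESS_F − 1)/N`: the population meaning of the engine's `ess` diagnostic ("`N·ESS_F`
  evolutions' worth of an unweighted average").
* `identDistrib_comp_eval_infinitePi`, `pairwise_indepFun_comp_eval_infinitePi` — the coordinates
  of an infinite i.i.d. run, read through a measurable `g`, are identically distributed and
  pairwise independent (Mathlib `infinitePi_map_eval`, `iIndepFun_infinitePi`);
  **`tendsto_sampleMean_ae`** — the strong law for them: `(1/n) Σ_{i<n} g(ω i) → E_μ[g]` a.s.
* **`tendsto_jarzynskiEstimate_ae`** / **`CrooksPair.tendsto_jarzynskiEstimate_ae`** — STRONG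
  CONSISTENCY OF `ΔF̂`: for every Crooks pair on a general measurable state space,
  `ΔF̂_n → ΔF` almost surely along an infinite run of independent forward evolutions.
* **`tendsto_essHat_ae`** / **`CrooksPair.tendsto_essHat_ae`** — the reported Kish fraction
  `essHat (e^{−W_i})_{i<n} = (Σ w)²/(n Σ w²)` converges a.s. to the population `ESS_F` of
  `NCMCGeneralSpaceDissipation.lean` (weights in `L²(P_F)`, i.e. `E_F e^{−2W} < ∞`).
* `CrooksPair.integral_comp_end_mul_exp_neg_work` — `E_{P_F}[f(end) e^{−W}] = Z₀⁻¹ ∫ f dν₁` for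
  every `f` (the reweighting identity for END-POINT observables of a general Crooks pair), and
  **`CrooksPair.tendsto_reweighted_ae`** — the self-normalised estimator
  `Σ f(end_i) e^{−W_i} / Σ e^{−W_i}` converges a.s. to the TARGET expectation `(ν₁ Ω)⁻¹ ∫ f dν₁`
  (row 30's `ratio_estimator_consistent` instantiated: E4′ for every protocol certified as a Crooks
  pair — adjoint stochastic steps, Jacobian-charged layers, concatenations).

Scope: independent evolutions; nothing is claimed about rates of convergence or about correlated
chain starts.
-/

namespace Summit.Ventures.LatticeQCDFlow.Exactness.GeneralNCMC

open MeasureTheory ProbabilityTheory Set Filter Finset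
open scoped ENNReal Topology

variable {E : Type*} [MeasurableSpace E]

/-! ## The variance of the exponential average -/

/-- **`Var[(1/N) Σ_i w(y i)] = Var_μ[w] / N`** for `N ≥ 1` i.i.d. records and `w ∈ L²(μ)`
(independent coordinates: Mathlib's `variance_sum_pi`). -/
theorem variance_sampleMean_pi (μ : Measure E) [IsProbabilityMeasure μ] {w : E → ℝ}
    (hw : MemLp w 2 μ) {N : ℕ} (hN : 0 < N) :
    Var[fun y : Fin N → E => sampleMean w y; Measure.pi fun _ : Fin N => μ] = Var[w; μ] / N := by
  have hfun : (fun y : Fin N → E => sampleMean w y) =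
      fun y => (N : ℝ)⁻¹ * (∑ i : Fin N, fun y : Fin N → E => w (y i)) y := by
    funext y
    unfold sampleMean
    rw [Finset.sum_apply, div_eq_inv_mul]
  have hN' : (N : ℝ) ≠ 0 := by exact_mod_cast hN.ne'
  rw [hfun, variance_const_mul, variance_sum_pi (fun _ => hw), sum_const, card_univ,
    Fintype.card_fin, nsmul_eq_mul]
  field_simp

namespace CrooksPair

variable {Ω : Type*} [MeasurableSpace Ω]
variable {ν₀ ν₁ : Measure Ω} {κF κR : Kernel Ω E} {s e : E → Ω} {W : E → ℝ}

/-- `Var_{P_F}[e^{−W}] = E_F[e^{−2W}] − (Z₁/Z₀)²` for a square-integrable Jarzynski weight. -/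
theorem variance_exp_neg_work [IsFiniteMeasure ν₀] [IsMarkovKernel κF] [IsMarkovKernel κR]
    (h0 : ν₀ univ ≠ 0) (h : CrooksPair ν₀ ν₁ κF κR s e W)
    (hL2 : MemLp (fun ε => Real.exp (-W ε)) 2 (fwdPathLaw ν₀ κF)) :
    Var[fun ε => Real.exp (-W ε); fwdPathLaw ν₀ κF] =
      ∫ ε, Real.exp (-(2 * W ε)) ∂(fwdPathLaw ν₀ κF) - ((ν₀ univ)⁻¹ * ν₁ univ).toReal ^ 2 := by
  haveI := isProbabilityMeasure_fwdPathLaw ν₀ h0 κF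
  rw [variance_eq_sub hL2, h.integral_exp_neg_work]
  congr 1
  refine integral_congr_ae (Eventually.of_forall fun ε => ?_)
  simp only [Pi.pow_apply]
  rw [sq, ← Real.exp_add]
  congr 1
  ring

/-- **The relative variance of the Jarzynski weight is `1/ESS_F − 1`**:
`Var_{P_F}[e^{−W}] / (E_F e^{−W})² = E_F[e^{−2W}] / (E_F e^{−W})² − 1`, the right side being
`1/ESS_F − 1` with `ESS_F = (E_F e^{−W})² / E_F e^{−2W}` of `NCMCGeneralSpaceDissipation.lean`
(Kong's `ESS = n/(1 + cv²)` in population). -/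
theorem variance_exp_neg_work_div_sq [IsFiniteMeasure ν₀] [IsFiniteMeasure ν₁] [IsMarkovKernel κF]
    [IsMarkovKernel κR] (h0 : ν₀ univ ≠ 0) (h1 : ν₁ univ ≠ 0) (h : CrooksPair ν₀ ν₁ κF κR s e W)
    (hL2 : MemLp (fun ε => Real.exp (-W ε)) 2 (fwdPathLaw ν₀ κF)) :
    Var[fun ε => Real.exp (-W ε); fwdPathLaw ν₀ κF] / (∫ ε, Real.exp (-W ε) ∂(fwdPathLaw ν₀ κF)) ^ 2 =
      (∫ ε, Real.exp (-(2 * W ε)) ∂(fwdPathLaw ν₀ κF)) /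
          (∫ ε, Real.exp (-W ε) ∂(fwdPathLaw ν₀ κF)) ^ 2 - 1 := by
  have hr := toReal_ratio_pos (ν₀ := ν₀) (ν₁ := ν₁) h0 h1
  rw [h.variance_exp_neg_work h0 hL2, h.integral_exp_neg_work, sub_div, div_self (pow_ne_zero 2 hr.ne')]

/-- **The `N`-evolution exponential average has relative variance `(1/ESS_F − 1)/N`**:
`Var[(1/N) Σ_i e^{−W_i}] / (e^{−ΔF})² = (E_F[e^{−2W}] / (E_F e^{−W})² − 1) / N` for `N ≥ 1`
independent forward evolutions with square-integrable weight. -/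
theorem variance_sampleMean_exp_neg_work [IsFiniteMeasure ν₀] [IsFiniteMeasure ν₁]
    [IsMarkovKernel κF] [IsMarkovKernel κR] (h0 : ν₀ univ ≠ 0) (h1 : ν₁ univ ≠ 0)
    (h : CrooksPair ν₀ ν₁ κF κR s e W)
    (hL2 : MemLp (fun ε => Real.exp (-W ε)) 2 (fwdPathLaw ν₀ κF)) {N : ℕ} (hN : 0 < N) :
    Var[fun y : Fin N → E => sampleMean (fun ε => Real.exp (-W ε)) y;
        Measure.pi fun _ : Fin N => fwdPathLaw ν₀ κF] /
        (∫ ε, Real.exp (-W ε) ∂(fwdPathLaw ν₀ κF)) ^ 2 =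
      ((∫ ε, Real.exp (-(2 * W ε)) ∂(fwdPathLaw ν₀ κF)) /
          (∫ ε, Real.exp (-W ε) ∂(fwdPathLaw ν₀ κF)) ^ 2 - 1) / N := by
  haveI := isProbabilityMeasure_fwdPathLaw ν₀ h0 κF
  rw [variance_sampleMean_pi (fwdPathLaw ν₀ κF) hL2 hN, ← h.variance_exp_neg_work_div_sq h0 h1 hL2,
    div_div, div_div, mul_comm]

end CrooksPair

/-! ## Infinite i.i.d. runs: identical distribution, independence, the strong law -/

/-- The coordinates of an infinite i.i.d. run, read through a measurable `g`, are identically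
distributed. -/
theorem identDistrib_comp_eval_infinitePi (μ : Measure E) [IsProbabilityMeasure μ] {g : E → ℝ}
    (hg : Measurable g) (i : ℕ) :
    IdentDistrib (fun ω : ℕ → E => g (ω i)) (fun ω : ℕ → E => g (ω 0))
      (Measure.infinitePi fun _ : ℕ => μ) (Measure.infinitePi fun _ : ℕ => μ) where
  aemeasurable_fst := (hg.comp (measurable_pi_apply i)).aemeasurable
  aemeasurable_snd := (hg.comp (measurable_pi_apply 0)).aemeasurable
  map_eq := by
    rw [show (fun ω : ℕ → E => g (ω i)) = g ∘ fun ω => ω i from rfl,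
      show (fun ω : ℕ → E => g (ω 0)) = g ∘ fun ω => ω 0 from rfl,
      ← Measure.map_map hg (measurable_pi_apply i), ← Measure.map_map hg (measurable_pi_apply 0),
      Measure.infinitePi_map_eval, Measure.infinitePi_map_eval]

/-- … and pairwise independent (Mathlib `iIndepFun_infinitePi`). -/
theorem pairwise_indepFun_comp_eval_infinitePi (μ : Measure E) [IsProbabilityMeasure μ]
    {g : E → ℝ} (hg : Measurable g) :
    Pairwise fun i j => IndepFun (fun ω : ℕ → E => g (ω i)) (fun ω : ℕ → E => g (ω j))
      (Measure.infinitePi fun _ : ℕ => μ) :=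
  fun _ _ hij =>
    (iIndepFun_infinitePi (P := fun _ : ℕ => μ) (X := fun _ : ℕ => g) fun _ => hg).indepFun hij

/-- A function of ONE coordinate of an infinite i.i.d. run integrates to its `μ`-mean. -/
theorem integral_comp_eval_infinitePi (μ : Measure E) [IsProbabilityMeasure μ] {g : E → ℝ}
    (hg : AEStronglyMeasurable g μ) (i : ℕ) :
    ∫ ω, g (ω i) ∂(Measure.infinitePi fun _ : ℕ => μ) = ∫ a, g a ∂μ := by
  have hmp := measurePreserving_eval_infinitePi (fun _ : ℕ => μ) i
  calc ∫ ω, g (ω i) ∂(Measure.infinitePi fun _ : ℕ => μ)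
      = ∫ a, g a ∂((Measure.infinitePi fun _ : ℕ => μ).map (Function.eval i)) :=
        (integral_map hmp.measurable.aemeasurable (by rw [hmp.map_eq]; exact hg)).symm
    _ = ∫ a, g a ∂μ := by rw [hmp.map_eq]

/-- **Strong law for the sample means of an infinite i.i.d. run**: for an integrable measurable `g`,
`(1/n) Σ_{i<n} g(ω i) → E_μ[g]` for almost every run `ω` (Etemadi's pairwise version,
`ProbabilityTheory.strong_law_ae`). -/
theorem tendsto_sampleMean_ae (μ : Measure E) [IsProbabilityMeasure μ] {g : E → ℝ}
    (hg : Measurable g) (hgi : Integrable g μ) :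
    ∀ᵐ ω ∂(Measure.infinitePi fun _ : ℕ => μ),
      Tendsto (fun n : ℕ => sampleMean g (fun i : Fin n => ω i)) atTop (𝓝 (∫ a, g a ∂μ)) := by
  have hint : Integrable (fun ω : ℕ → E => g (ω 0)) (Measure.infinitePi fun _ : ℕ => μ) :=
    (measurePreserving_eval_infinitePi (fun _ : ℕ => μ) 0).integrable_comp_of_integrable hgi
  have hsl := strong_law_ae (μ := Measure.infinitePi fun _ : ℕ => μ)
    (fun i (ω : ℕ → E) => g (ω i)) hint (pairwise_indepFun_comp_eval_infinitePi μ hg)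
    (identDistrib_comp_eval_infinitePi μ hg)
  filter_upwards [hsl] with ω hω
  rw [integral_comp_eval_infinitePi μ hg.aestronglyMeasurable 0] at hω
  refine hω.congr fun n => ?_
  unfold sampleMean
  rw [smul_eq_mul, Fin.sum_univ_eq_sum_range (fun i => g (ω i)) n, div_eq_inv_mul]

/-- **Strong consistency of the Jarzynski estimate**: for a positive measurable integrable weight,
`−log ((1/n) Σ_{i<n} w(ω i)) → −log E_μ[w]` for almost every infinite i.i.d. run `ω`. -/
theorem tendsto_jarzynskiEstimate_ae (μ : Measure E) [IsProbabilityMeasure μ] {w : E → ℝ}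
    (hwm : Measurable w) (hwpos : ∀ a, 0 < w a) (hwi : Integrable w μ) :
    ∀ᵐ ω ∂(Measure.infinitePi fun _ : ℕ => μ),
      Tendsto (fun n : ℕ => jarzynskiEstimate w (fun i : Fin n => ω i)) atTop
        (𝓝 (-Real.log (∫ a, w a ∂μ))) := by
  have hpos : 0 < ∫ a, w a ∂μ := by
    rw [integral_pos_iff_support_of_nonneg (fun a => (hwpos a).le) hwi]
    have hsupp : Function.support w = univ := by
      ext a
      simp only [Function.mem_support, mem_univ, iff_true]
      exact (hwpos a).ne'
    rw [hsupp, measure_univ]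
    exact one_pos
  filter_upwards [tendsto_sampleMean_ae μ hwm hwi] with ω hω
  unfold jarzynskiEstimate
  exact (hω.log hpos.ne').neg

/-- **Strong consistency of the Kish fraction**: for a measurable weight in `L²(μ)` with
`E_μ[w²] ≠ 0`, `essHat (w(ω i))_{i<n} = (Σ w)² / (n Σ w²) → (E_μ w)² / E_μ[w²]` for almost every
infinite i.i.d. run. -/
theorem tendsto_essHat_ae (μ : Measure E) [IsProbabilityMeasure μ] {w : E → ℝ}
    (hwm : Measurable w) (hL2 : MemLp w 2 μ) (hsq : ∫ a, w a ^ 2 ∂μ ≠ 0) :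
    ∀ᵐ ω ∂(Measure.infinitePi fun _ : ℕ => μ),
      Tendsto (fun n : ℕ => essHat (fun i : Fin n => w (ω i))) atTop
        (𝓝 ((∫ a, w a ∂μ) ^ 2 / ∫ a, w a ^ 2 ∂μ)) := by
  have h1 := tendsto_sampleMean_ae μ hwm (hL2.integrable one_le_two)
  have h2 := tendsto_sampleMean_ae μ (hwm.pow_const 2) hL2.integrable_sq
  filter_upwards [h1, h2] with ω hω1 hω2
  have hlim : Tendsto (fun n : ℕ => (sampleMean w fun i : Fin n => ω i) ^ 2 /
      sampleMean (fun x => w x ^ 2) fun i : Fin n => ω i) atTop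
      (𝓝 ((∫ a, w a ∂μ) ^ 2 / ∫ a, w a ^ 2 ∂μ)) := (hω1.pow 2).div hω2 hsq
  refine hlim.congr' ?_
  filter_upwards [eventually_gt_atTop 0] with n hn
  simp only [essHat, sampleMean, Fintype.card_fin]
  have hn' : (n : ℝ) ≠ 0 := by exact_mod_cast hn.ne'
  rcases eq_or_ne (∑ i : Fin n, w (ω i) ^ 2) 0 with hz | hz
  · rw [hz, zero_div, mul_zero, div_zero, div_zero]
  · field_simp

/-! ## For a Crooks pair: `ΔF̂_n → ΔF`, `essHat → ESS_F`, reweighted observables → target means -/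

namespace CrooksPair

variable {Ω : Type*} [MeasurableSpace Ω]
variable {ν₀ ν₁ : Measure Ω} {κF κR : Kernel Ω E} {s e : E → Ω} {W : E → ℝ}

/-- **`ΔF̂_n → ΔF` almost surely**, for every Crooks pair on a general measurable state space and
an infinite run of independent forward evolutions from prior equilibrium
(law `Measure.infinitePi (fun _ => P_F)`). -/
theorem tendsto_jarzynskiEstimate_ae [IsFiniteMeasure ν₀] [IsFiniteMeasure ν₁] [IsMarkovKernel κF]
    [IsMarkovKernel κR] (h0 : ν₀ univ ≠ 0) (h : CrooksPair ν₀ ν₁ κF κR s e W) {ΔF : ℝ}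
    (hΔF : Real.exp (-ΔF) = ((ν₀ univ)⁻¹ * ν₁ univ).toReal) :
    haveI := isProbabilityMeasure_fwdPathLaw ν₀ h0 κF
    ∀ᵐ ω ∂(Measure.infinitePi fun _ : ℕ => fwdPathLaw ν₀ κF),
      Tendsto (fun n : ℕ => jarzynskiEstimate (fun ε => Real.exp (-W ε)) (fun i : Fin n => ω i))
        atTop (𝓝 ΔF) := by
  haveI := isProbabilityMeasure_fwdPathLaw ν₀ h0 κF
  have key := GeneralNCMC.tendsto_jarzynskiEstimate_ae (fwdPathLaw ν₀ κF)
    (w := fun ε => Real.exp (-W ε)) (Real.measurable_exp.comp h.measurable_W.neg)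
    (fun ε => Real.exp_pos _) (h.integrable_exp_neg_work h0)
  rwa [h.integral_exp_neg_work, ← hΔF, Real.log_exp, neg_neg] at key

/-- **The reported ESS fraction converges to the population ESS**: for every Crooks pair with
`e^{−W} ∈ L²(P_F)` (i.e. `E_F e^{−2W} < ∞`), almost surely along an infinite run of independent
forward evolutions `essHat (e^{−W_i})_{i<n} → ESS_F = (E_F e^{−W})² / E_F e^{−2W}`
(`NCMCGeneralSpaceDissipation.essPop_eq_inv_dissipation`: `= 1 / E_F e^{−2(W−ΔF)}`). -/
theorem tendsto_essHat_ae [IsFiniteMeasure ν₀] [IsMarkovKernel κF] (h0 : ν₀ univ ≠ 0)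
    (h : CrooksPair ν₀ ν₁ κF κR s e W) (hL2 : MemLp (fun ε => Real.exp (-W ε)) 2 (fwdPathLaw ν₀ κF)) :
    haveI := isProbabilityMeasure_fwdPathLaw ν₀ h0 κF
    ∀ᵐ ω ∂(Measure.infinitePi fun _ : ℕ => fwdPathLaw ν₀ κF),
      Tendsto (fun n : ℕ => essHat (fun i : Fin n => Real.exp (-W (ω i)))) atTop
        (𝓝 ((∫ ε, Real.exp (-W ε) ∂(fwdPathLaw ν₀ κF)) ^ 2 /
          ∫ ε, Real.exp (-(2 * W ε)) ∂(fwdPathLaw ν₀ κF))) := by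
  haveI := isProbabilityMeasure_fwdPathLaw ν₀ h0 κF
  have hsq_form : ∫ ε, Real.exp (-W ε) ^ 2 ∂(fwdPathLaw ν₀ κF) =
      ∫ ε, Real.exp (-(2 * W ε)) ∂(fwdPathLaw ν₀ κF) := by
    refine integral_congr_ae (Eventually.of_forall fun ε => ?_)
    simp only
    rw [sq, ← Real.exp_add]
    congr 1
    ring
  have hint2 : Integrable (fun ε => Real.exp (-(2 * W ε))) (fwdPathLaw ν₀ κF) := by
    refine hL2.integrable_sq.congr (Eventually.of_forall fun ε => ?_)
    simp only
    rw [sq, ← Real.exp_add]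
    congr 1
    ring
  have hsq : ∫ ε, Real.exp (-W ε) ^ 2 ∂(fwdPathLaw ν₀ κF) ≠ 0 := by
    rw [hsq_form]
    exact (integral_exp_pos hint2).ne'
  have key := GeneralNCMC.tendsto_essHat_ae (fwdPathLaw ν₀ κF) (w := fun ε => Real.exp (-W ε))
    (Real.measurable_exp.comp h.measurable_W.neg) hL2 hsq
  rw [hsq_form] at key
  exact key

/-- **The reweighting identity for end-point observables of a Crooks pair**:
`E_{P_F}[e^{−W} f(end)] = (ν₀ Ω)⁻¹ ∫ f dν₁` for every `f` (the end-point marginal of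
`e^{−W} · P_F = Z₀⁻¹ (ν₁ ∘ κR)` is `Z₀⁻¹ ν₁`, `NCMCGeneralSpacePathIMH.pathIMH_target_marginal`). -/
theorem integral_exp_neg_work_mul_comp_end [IsMarkovKernel κR] (h : CrooksPair ν₀ ν₁ κF κR s e W)
    {f : Ω → ℝ} (hf : AEStronglyMeasurable f ν₁) :
    ∫ ε, Real.exp (-W ε) * f (e ε) ∂(fwdPathLaw ν₀ κF) = ((ν₀ univ)⁻¹).toReal * ∫ y, f y ∂ν₁ := by
  have hρ : Measurable fun ε => ENNReal.ofReal (Real.exp (-W ε)) :=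
    (Real.measurable_exp.comp h.measurable_W.neg).ennreal_ofReal
  have hlt : ∀ᵐ ε ∂(fwdPathLaw ν₀ κF), ENNReal.ofReal (Real.exp (-W ε)) < ∞ :=
    Eventually.of_forall fun _ => ENNReal.ofReal_lt_top
  have hmeas : ((fwdPathLaw ν₀ κF).withDensity fun ε => ENNReal.ofReal (Real.exp (-W ε))).map e =
      (ν₀ univ)⁻¹ • ν₁ := by
    rw [h.fwdPathLaw_withDensity, h.pathIMH_target_marginal]
  calc ∫ ε, Real.exp (-W ε) * f (e ε) ∂(fwdPathLaw ν₀ κF)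
      = ∫ ε, (ENNReal.ofReal (Real.exp (-W ε))).toReal • f (e ε) ∂(fwdPathLaw ν₀ κF) := by
        refine integral_congr_ae (Eventually.of_forall fun ε => ?_)
        simp only
        rw [ENNReal.toReal_ofReal (Real.exp_pos _).le, smul_eq_mul]
    _ = ∫ ε, f (e ε) ∂((fwdPathLaw ν₀ κF).withDensity fun ε => ENNReal.ofReal (Real.exp (-W ε))) :=
        (integral_withDensity_eq_integral_toReal_smul hρ hlt _).symm
    _ = ∫ y, f y ∂(((fwdPathLaw ν₀ κF).withDensity fun ε => ENNReal.ofReal (Real.exp (-W ε))).map e) :=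
        (integral_map h.measurable_e.aemeasurable (by rw [hmeas]; exact hf.smul_measure _)).symm
    _ = ∫ y, f y ∂((ν₀ univ)⁻¹ • ν₁) := by rw [hmeas]
    _ = ((ν₀ univ)⁻¹).toReal * ∫ y, f y ∂ν₁ := by rw [integral_smul_measure, smul_eq_mul]

/-- **Strong consistency of reweighted end-point observables (E4′ for every Crooks pair).**  Along
an infinite run of independent forward evolutions, the self-normalised estimator
`Σ_{i<n} e^{−W_i} f(end_i) / Σ_{i<n} e^{−W_i}` converges almost surely to the TARGET expectation
`(ν₁ Ω)⁻¹ ∫ f dν₁`, for every measurable `f` with `e^{−W} f(end)` integrable under `P_F` (row 30's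
`ratio_estimator_consistent'` with `c = Z₁/Z₀`). -/
theorem tendsto_reweighted_ae [IsFiniteMeasure ν₀] [IsFiniteMeasure ν₁] [IsMarkovKernel κF]
    [IsMarkovKernel κR] (h0 : ν₀ univ ≠ 0) (h1 : ν₁ univ ≠ 0) (h : CrooksPair ν₀ ν₁ κF κR s e W)
    {f : Ω → ℝ} (hfm : Measurable f)
    (hA : Integrable (fun ε => Real.exp (-W ε) * f (e ε)) (fwdPathLaw ν₀ κF)) :
    haveI := isProbabilityMeasure_fwdPathLaw ν₀ h0 κF
    ∀ᵐ ω ∂(Measure.infinitePi fun _ : ℕ => fwdPathLaw ν₀ κF),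
      Tendsto (fun n : ℕ => (∑ i ∈ range n, Real.exp (-W (ω i)) * f (e (ω i))) /
        ∑ i ∈ range n, Real.exp (-W (ω i))) atTop (𝓝 (((ν₁ univ)⁻¹).toReal * ∫ y, f y ∂ν₁)) := by
  haveI := isProbabilityMeasure_fwdPathLaw ν₀ h0 κF
  have hgA : Measurable fun ε => Real.exp (-W ε) * f (e ε) :=
    (Real.measurable_exp.comp h.measurable_W.neg).mul (hfm.comp h.measurable_e)
  have hgB : Measurable fun ε => Real.exp (-W ε) := Real.measurable_exp.comp h.measurable_W.neg
  have hmp := measurePreserving_eval_infinitePi (fun _ : ℕ => fwdPathLaw ν₀ κF) 0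
  have hZ1 : (ν₁ univ).toReal ≠ 0 := (ENNReal.toReal_pos h1 (measure_ne_top ν₁ univ)).ne'
  have hZ0 : (ν₀ univ).toReal ≠ 0 := (ENNReal.toReal_pos h0 (measure_ne_top ν₀ univ)).ne'
  refine ratio_estimator_consistent' (μ := Measure.infinitePi fun _ : ℕ => fwdPathLaw ν₀ κF)
    (fun i (ω : ℕ → E) => Real.exp (-W (ω i)) * f (e (ω i))) (fun i (ω : ℕ → E) => Real.exp (-W (ω i)))
    (hmp.integrable_comp_of_integrable hA)
    (hmp.integrable_comp_of_integrable (h.integrable_exp_neg_work h0))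
    (pairwise_indepFun_comp_eval_infinitePi _ hgA) (pairwise_indepFun_comp_eval_infinitePi _ hgB)
    (identDistrib_comp_eval_infinitePi _ hgA) (identDistrib_comp_eval_infinitePi _ hgB)
    (c := ((ν₀ univ)⁻¹ * ν₁ univ).toReal) (m := ((ν₁ univ)⁻¹).toReal * ∫ y, f y ∂ν₁)
    (toReal_ratio_pos h0 h1).ne' ?_ ?_
  · rw [integral_comp_eval_infinitePi (fwdPathLaw ν₀ κF) hgA.aestronglyMeasurable 0,
      h.integral_exp_neg_work_mul_comp_end hfm.aestronglyMeasurable, ENNReal.toReal_mul,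
      ENNReal.toReal_inv, ENNReal.toReal_inv]
    field_simp
  · rw [integral_comp_eval_infinitePi (fwdPathLaw ν₀ κF) hgB.aestronglyMeasurable 0,
      h.integral_exp_neg_work]

end CrooksPair

end Summit.Ventures.LatticeQCDFlow.Exactness.GeneralNCMC
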